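import Summits.Ventures.CertifiedManyBodySolver.Theorems.TcThermcert1HighTempTimeReversal
import Summits.Ventures.CertifiedManyBodySolver.Theorems.TcThermcert1HighTempRootedAnimals
import Summits.Ventures.CertifiedManyBodySolver.Theorems.TcThermcert1QbpSectorBookkeeping
import Literature.MathematicalPhysics.QuantumLattice.HubbardTorusCharges
import HarnessLib

/-!
# High-temperature current clustering for TcThermcert1's Hypothesis C — part 3: the polymer expansion and the time-reversal vanishing

Helper file for route `TcThermcert1` (crux K1′ `ThermalStiffnessCeilingU8b8_le_7o44`, item `stmt-Ventures-24560`; line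
`Cruxes/ThermalStiffnessCeilingU8b8_le_7o44/Lines/gauge_qbp_far_seam.lean`, small-`β` rung `stub_currentClustering8_smallBeta`).
For the Hubbard Hamiltonian `H = Σ_Z h_Z` on a finite graph written as the sum of its local terms `h_Z = hubbardTermOp G t U μ Z`
(cells `Z : HubbardIdx G` with supports `hubbardTermSupp G Z`) and a bond `{a, b}`:

* §1 terms with disjoint supports commute, so the partial Boltzmann factors `e^{−β H_T}`, `H_T = Σ_{Z ∈ T} h_Z`, and the MÖBIUS WEIGHTS
  `ρ_K = Σ_{T ⊆ K} (−1)^{|K ∖ T|} e^{−β H_T}` are multiplicative over support-disjoint unions;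
* §2 **the polymer expansion around the bond** (exact, every `β`):
  `e^{−βH} = Σ_{K admissible} ρ_K · e^{−β H_{far(K)}}`, the sum over the sets `K` of terms all of whose cells are attached to `{a,b}`
  through `K`, `far(K)` = the terms none of whose sites is reachable from `{a,b}` through `K` (Möbius inversion + the attached/far
  fibration of part 2 + resummation of the far weights);
* §3 **time-reversal vanishing**: if no site of `X` is reachable through the admissible `K`, then for every even observable `A` of `X`
  and every spin sector `(M,N)`, `tr(P_{M,N} ρ_K e^{−βH_{far(K)}} A j_{ab}) = 0` — regional resolution of the identity (part 1), trace
  factorisation over the reachable region `S` and its complement (`trace_mul_of_mem_carSubalgebra`), and `tr(j · (P^S_{uv} ρ_K)) = 0`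
  (antisymmetric × symmetric);
* §4 hence `tr(P_{M,N} e^{−βH} A j_{ab}) = Σ_{K admissible, reaching X} tr(P_{M,N} ρ_K e^{−βH_{far(K)}} A j_{ab})`.

[cite: Ueltschi1999, §2.3 (polymer expansion of quantum lattice systems)] Finite-dimensional algebra; no estimate yet (parts 4–5).
HONEST FRAMING: nothing here is a `T_c` estimate; K1′/K1 remain CONDITIONAL ceilings; superconductivity in the Hubbard model is NOT
proved by anything in this file. No definitions; no `sorry`.
-/

noncomputable section

namespace Summit.Ventures.CertifiedManyBodySolver.Theorems.TcThermcert1.HighTempCurrentClustering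

open Matrix Finset
open Literature.MathematicalPhysics.QuantumLattice
open Literature.Probability.LatticeModels
open Summit.Ventures.CertifiedManyBodySolver.Theorems.TcThermcert1.GaugeQbpFarSeam
open scoped Matrix.Norms.L2Operator Classical

variable {Λ : Type*} [LinearOrder Λ] [Fintype Λ] (G : SimpleGraph Λ) [DecidableRel G.Adj] (t U μ : ℝ)

/-! ## §1 Support-disjoint terms commute; multiplicativity of partial Boltzmann factors and Möbius weights -/

omit [DecidableRel G.Adj] in
/-- Terms with disjoint supports commute. [folklore] -/
theorem commute_hubbardTermOp_of_disjoint_supp {Z Z' : HubbardIdx G}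
    (h : Disjoint (hubbardTermSupp G Z) (hubbardTermSupp G Z')) :
    Commute (hubbardTermOp G t U μ Z) (hubbardTermOp G t U μ Z') :=
  commute_hubbardTermOp_of_disjoint G t U μ Z
    (carEvenSubalgebra_le_carSubalgebra _ (hubbardTermOp_mem_carEvenSubalgebra G t U μ Z')) h

omit [DecidableRel G.Adj] in
/-- Partial Hamiltonians over support-disjoint sets of terms commute. [folklore] -/
theorem commute_sum_hubbardTermOp_of_disjoint_supp {K T : Finset (HubbardIdx G)}
    (h : ∀ Z ∈ K, ∀ Z' ∈ T, Disjoint (hubbardTermSupp G Z) (hubbardTermSupp G Z')) :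
    Commute (∑ Z ∈ K, hubbardTermOp G t U μ Z) (∑ Z ∈ T, hubbardTermOp G t U μ Z) :=
  Commute.sum_left _ _ _ fun Z hZ => Commute.sum_right _ _ _ fun Z' hZ' =>
    commute_hubbardTermOp_of_disjoint_supp G t U μ (h Z hZ Z' hZ')

omit [Fintype Λ] [DecidableRel G.Adj] in
/-- Support-disjoint sets of terms are disjoint (supports are nonempty). [folklore] -/
theorem disjoint_of_disjoint_supp {K T : Finset (HubbardIdx G)}
    (h : ∀ Z ∈ K, ∀ Z' ∈ T, Disjoint (hubbardTermSupp G Z) (hubbardTermSupp G Z')) : Disjoint K T := by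
  rw [Finset.disjoint_left]
  intro Z hZK hZT
  obtain ⟨x, hx⟩ := hubbardTermSupp_nonempty G Z
  exact Finset.disjoint_left.1 (h Z hZK Z hZT) hx hx

omit [DecidableRel G.Adj] in
/-- **Partial Boltzmann factors multiply over support-disjoint unions**: `e^{−βH_{K ∪ T}} = e^{−βH_K} e^{−βH_T}`. [folklore] -/
theorem gibbsWeight_sum_union_of_disjoint_supp (β : ℝ) {K T : Finset (HubbardIdx G)}
    (h : ∀ Z ∈ K, ∀ Z' ∈ T, Disjoint (hubbardTermSupp G Z) (hubbardTermSupp G Z')) :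
    gibbsWeight β (∑ Z ∈ K ∪ T, hubbardTermOp G t U μ Z) =
      gibbsWeight β (∑ Z ∈ K, hubbardTermOp G t U μ Z) * gibbsWeight β (∑ Z ∈ T, hubbardTermOp G t U μ Z) := by
  rw [gibbsWeight, gibbsWeight, gibbsWeight, Finset.sum_union (disjoint_of_disjoint_supp G h), smul_add]
  exact Matrix.exp_add_of_commute _ _ (((commute_sum_hubbardTermOp_of_disjoint_supp G t U μ h).smul_left _).smul_right _)

omit [DecidableRel G.Adj] in
/-- **Möbius weights multiply over support-disjoint unions**: `ρ_{K ∪ T} = ρ_K ρ_T`. [cite: Ueltschi1999, §2.3 (ρ(𝒜) factorises)] -/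
theorem weight_union_of_disjoint_supp (β : ℝ) {K T : Finset (HubbardIdx G)}
    (h : ∀ Z ∈ K, ∀ Z' ∈ T, Disjoint (hubbardTermSupp G Z) (hubbardTermSupp G Z')) :
    ∑ S ∈ (K ∪ T).powerset, ((-1 : ℂ) ^ ((K ∪ T) \ S).card) • gibbsWeight β (∑ Z ∈ S, hubbardTermOp G t U μ Z) =
      (∑ A ∈ K.powerset, ((-1 : ℂ) ^ (K \ A).card) • gibbsWeight β (∑ Z ∈ A, hubbardTermOp G t U μ Z)) *
        (∑ B ∈ T.powerset, ((-1 : ℂ) ^ (T \ B).card) • gibbsWeight β (∑ Z ∈ B, hubbardTermOp G t U μ Z)) := by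
  have hKT := disjoint_of_disjoint_supp G h
  rw [sum_powerset_union_eq_sum_sum' hKT, Finset.sum_mul_sum]
  refine Finset.sum_congr rfl fun A hA => Finset.sum_congr rfl fun B hB => ?_
  have hA' := Finset.mem_powerset.1 hA
  have hB' := Finset.mem_powerset.1 hB
  rw [card_union_sdiff_union hKT hA' hB', pow_add,
    gibbsWeight_sum_union_of_disjoint_supp G t U μ β (fun Z hZ Z' hZ' => h Z (hA' hZ) Z' (hB' hZ')),
    smul_mul_assoc, mul_smul_comm, smul_smul]

omit [DecidableRel G.Adj] in
/-- **Möbius inversion for the partial Boltzmann factors**: `e^{−βH_P} = Σ_{Q ⊆ P} ρ_Q`. [cite: Ueltschi1999, §2.3] -/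
theorem gibbsWeight_sum_eq_sum_weight (β : ℝ) (P : Finset (HubbardIdx G)) :
    gibbsWeight β (∑ Z ∈ P, hubbardTermOp G t U μ Z) =
      ∑ Q ∈ P.powerset, ∑ T ∈ Q.powerset, ((-1 : ℂ) ^ (Q \ T).card) • gibbsWeight β (∑ Z ∈ T, hubbardTermOp G t U μ Z) := by
  rw [← sum_powerset_sum_powerset_neg_one_pow_smul (fun T => gibbsWeight β (∑ Z ∈ T, hubbardTermOp G t U μ Z)) P]
  refine Finset.sum_congr rfl fun Q _ => Finset.sum_congr rfl fun T _ => ?_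
  rw [← Int.cast_smul_eq_zsmul ℂ]
  push_cast
  rfl

/-! ## §2 The polymer expansion around the bond `{a, b}` -/

/-- **The polymer expansion of `e^{−βH}` around the bond** (exact identity):
`e^{−β Σ_Z h_Z} = Σ_{K admissible} ρ_K · e^{−β H_{far(K)}}`. [cite: Ueltschi1999, §2.3 (polymer representation)] -/
theorem gibbsWeight_eq_sum_admissible (β : ℝ) (a b : Λ) :
    gibbsWeight β (∑ Z, hubbardTermOp G t U μ Z) =
      ∑ K ∈ (Finset.univ : Finset (HubbardIdx G)).powerset.filter (fun K => ∀ Z ∈ K, ∃ w ∈ hubbardTermSupp G Z,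
          ∃ r ∈ ({a, b} : Finset Λ), Relation.ReflTransGen
            (fun x y : Λ => ∃ Z ∈ K, x ∈ hubbardTermSupp G Z ∧ y ∈ hubbardTermSupp G Z) r w),
        (∑ T ∈ K.powerset, ((-1 : ℂ) ^ (K \ T).card) • gibbsWeight β (∑ Z ∈ T, hubbardTermOp G t U μ Z)) *
          gibbsWeight β (∑ Z ∈ Finset.univ.filter (fun Z => ∀ w ∈ hubbardTermSupp G Z, ¬ ∃ r ∈ ({a, b} : Finset Λ),
            Relation.ReflTransGen (fun x y : Λ => ∃ Z ∈ K, x ∈ hubbardTermSupp G Z ∧ y ∈ hubbardTermSupp G Z) r w),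
            hubbardTermOp G t U μ Z) := by
  rw [gibbsWeight_sum_eq_sum_weight G t U μ β Finset.univ,
    sum_powerset_eq_sum_adm_sum_far (verts := hubbardTermSupp G) (Finset.univ : Finset (HubbardIdx G)) ({a, b} : Finset Λ)]
  -- (the index sets agree up to the choice of `Decidable` instances: `Finset.filter_congr_decidable`)
  refine Finset.sum_congr (Finset.filter_congr_decidable _ _ _) fun K hK => ?_
  obtain ⟨-, hKadm⟩ := Finset.mem_filter.1 hK
  have hW := gibbsWeight_sum_eq_sum_weight G t U μ β (Finset.univ.filter (fun Z => ∀ w ∈ hubbardTermSupp G Z,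
      ¬ ∃ r ∈ ({a, b} : Finset Λ), Relation.ReflTransGen
        (fun x y : Λ => ∃ Z ∈ K, x ∈ hubbardTermSupp G Z ∧ y ∈ hubbardTermSupp G Z) r w))
  rw [hW, Finset.mul_sum]
  refine Finset.sum_congr (congrArg _ (Finset.filter_congr_decidable _ _ _)) fun T hT => ?_
  have hfar : ∀ Z ∈ T, ∀ w ∈ hubbardTermSupp G Z, ¬ ∃ r ∈ ({a, b} : Finset Λ),
      Relation.ReflTransGen (fun x y : Λ => ∃ Z ∈ K, x ∈ hubbardTermSupp G Z ∧ y ∈ hubbardTermSupp G Z) r w :=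
    fun Z hZ => (Finset.mem_filter.1 (Finset.mem_powerset.1 hT hZ)).2
  exact weight_union_of_disjoint_supp G t U μ β (disjoint_verts_of_admissible_far hKadm hfar)

/-! ## §3 Time-reversal vanishing of the polymers that do not reach the test observable -/

/-- **Time-reversal vanishing.** For an admissible set of terms `K` through which no site of `X` is reachable from the bond `{a,b}`,
an even observable `A` of `X` and any spin sector `(M,N)`: `tr(P_{M,N} · ρ_K e^{−βH_{far(K)}} · A j_{ab}) = 0`.
Mechanism: with `S` the set of sites reachable through `K`, `ρ_K, j ∈ 𝔄⁺(S)` and `e^{−βH_{far}}, A ∈ 𝔄⁺(Sᶜ)`; inserting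
`1 = Σ_{uv} P^S_{uv}` and `P_{M,N} P^S_{uv} = D^{Sᶜ}_{uv} P^S_{uv}`, each term factorises as
`2^{−|Orb|} tr(D e^{−βH_far} A) · tr(P^S_{uv} ρ_K j)`, and `tr(P^S_{uv} ρ_K j) = tr(j · P^S_{uv} ρ_K) = 0` because `j` is
antisymmetric and `P^S_{uv} ρ_K` symmetric (`ρ_K` is a combination of real symmetric partial Boltzmann factors commuting with the
regional sector projections). [folklore] -/
theorem trace_term_eq_zero_of_not_reach (β : ℝ) (a b : Λ) (M N : ℕ) {K : Finset (HubbardIdx G)}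
    (hK : ∀ Z ∈ K, ∃ w ∈ hubbardTermSupp G Z, ∃ r ∈ ({a, b} : Finset Λ),
      Relation.ReflTransGen (fun x y : Λ => ∃ Z ∈ K, x ∈ hubbardTermSupp G Z ∧ y ∈ hubbardTermSupp G Z) r w)
    {X : Finset Λ} {A : Matrix (Finset (Orb Λ)) (Finset (Orb Λ)) ℂ} (hA : A ∈ carEvenSubalgebra (orbSet X))
    (hX : ∀ x ∈ X, ¬ ∃ r ∈ ({a, b} : Finset Λ),
      Relation.ReflTransGen (fun x y : Λ => ∃ Z ∈ K, x ∈ hubbardTermSupp G Z ∧ y ∈ hubbardTermSupp G Z) r x) :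
    (spinSectorProj M N *
        ((∑ T ∈ K.powerset, ((-1 : ℂ) ^ (K \ T).card) • gibbsWeight β (∑ Z ∈ T, hubbardTermOp G t U μ Z)) *
          gibbsWeight β (∑ Z ∈ Finset.univ.filter (fun Z => ∀ w ∈ hubbardTermSupp G Z, ¬ ∃ r ∈ ({a, b} : Finset Λ),
            Relation.ReflTransGen (fun x y : Λ => ∃ Z ∈ K, x ∈ hubbardTermSupp G Z ∧ y ∈ hubbardTermSupp G Z) r w),
            hubbardTermOp G t U μ Z)) *
        (A * ∑ σ : Fin 2, ((-Complex.I) • (creation (orb a σ) * annihilation (orb b σ)) +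
          Complex.I • (creation (orb b σ) * annihilation (orb a σ))))).trace = 0 := by
  set ρ : Matrix (Finset (Orb Λ)) (Finset (Orb Λ)) ℂ :=
    ∑ T ∈ K.powerset, ((-1 : ℂ) ^ (K \ T).card) • gibbsWeight β (∑ Z ∈ T, hubbardTermOp G t U μ Z) with hρ
  set f : Matrix (Finset (Orb Λ)) (Finset (Orb Λ)) ℂ :=
    gibbsWeight β (∑ Z ∈ Finset.univ.filter (fun Z => ∀ w ∈ hubbardTermSupp G Z, ¬ ∃ r ∈ ({a, b} : Finset Λ),
      Relation.ReflTransGen (fun x y : Λ => ∃ Z ∈ K, x ∈ hubbardTermSupp G Z ∧ y ∈ hubbardTermSupp G Z) r w),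
      hubbardTermOp G t U μ Z) with hf
  set j : Matrix (Finset (Orb Λ)) (Finset (Orb Λ)) ℂ := ∑ σ : Fin 2, ((-Complex.I) • (creation (orb a σ) * annihilation (orb b σ)) +
    Complex.I • (creation (orb b σ) * annihilation (orb a σ))) with hj
  set P : Matrix (Finset (Orb Λ)) (Finset (Orb Λ)) ℂ := spinSectorProj M N with hP
  -- the region reached from the bond through `K`
  set S : Finset Λ := Finset.univ.filter (fun y => ∃ r ∈ ({a, b} : Finset Λ),
    Relation.ReflTransGen (fun x y : Λ => ∃ Z ∈ K, x ∈ hubbardTermSupp G Z ∧ y ∈ hubbardTermSupp G Z) r y) with hS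
  have hmemS : ∀ y, y ∈ S ↔ ∃ r ∈ ({a, b} : Finset Λ),
      Relation.ReflTransGen (fun x y : Λ => ∃ Z ∈ K, x ∈ hubbardTermSupp G Z ∧ y ∈ hubbardTermSupp G Z) r y := fun y => by
    rw [hS, Finset.mem_filter]
    simp only [Finset.mem_univ, true_and]
  have hdisj : Disjoint (orbSet S) (orbSet Sᶜ) := disjoint_orbSet disjoint_compl_right
  have haS : a ∈ S := (hmemS a).2 ⟨a, by simp, Relation.ReflTransGen.refl⟩
  have hbS : b ∈ S := (hmemS b).2 ⟨b, by simp, Relation.ReflTransGen.refl⟩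
  have hKS : ∀ Z ∈ K, hubbardTermSupp G Z ⊆ S := fun Z hZ x hx => (hmemS x).2 (verts_reach_of_admissible hK Z hZ x hx)
  have hXS : X ⊆ Sᶜ := fun x hx => Finset.mem_compl.2 fun hxS => hX x hx ((hmemS x).1 hxS)
  -- memberships in the even algebras of `S` and `Sᶜ`
  have hterm : ∀ T ∈ K.powerset, (∑ Z ∈ T, hubbardTermOp G t U μ Z) ∈ carEvenSubalgebra (orbSet S) := fun T hT =>
    Subalgebra.sum_mem _ fun Z hZ => carEvenSubalgebra_mono (orbSet_mono (hKS Z (Finset.mem_powerset.1 hT hZ)))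
      (hubbardTermOp_mem_carEvenSubalgebra G t U μ Z)
  have hρmem : ρ ∈ carEvenSubalgebra (orbSet S) := by
    refine Subalgebra.sum_mem _ fun T hT => Subalgebra.smul_mem _ ?_ _
    rw [gibbsWeight]
    exact exp_mem_subalgebra _ (Subalgebra.smul_mem _ (hterm T hT) _)
  have hfmem : f ∈ carEvenSubalgebra (orbSet Sᶜ) := by
    rw [hf, gibbsWeight]
    refine exp_mem_subalgebra _ (Subalgebra.smul_mem _ (Subalgebra.sum_mem _ fun Z hZ => ?_) _)
    have hZfar := (Finset.mem_filter.1 hZ).2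
    exact carEvenSubalgebra_mono (orbSet_mono fun x hx => Finset.mem_compl.2 fun hxS => hZfar x hx ((hmemS x).1 hxS))
      (hubbardTermOp_mem_carEvenSubalgebra G t U μ Z)
  have hjmem : j ∈ carEvenSubalgebra (orbSet S) :=
    Subalgebra.sum_mem _ fun σ _ => Subalgebra.add_mem _
      (Subalgebra.smul_mem _ (creation_mul_annihilation_mem_carEvenSubalgebra (orb_mem_orbSet haS σ) (orb_mem_orbSet hbS σ)) _)
      (Subalgebra.smul_mem _ (creation_mul_annihilation_mem_carEvenSubalgebra (orb_mem_orbSet hbS σ) (orb_mem_orbSet haS σ)) _)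
  have hAmem : A ∈ carEvenSubalgebra (orbSet Sᶜ) := carEvenSubalgebra_mono (orbSet_mono hXS) hA
  have hfA : f * A ∈ carEvenSubalgebra (orbSet Sᶜ) := Subalgebra.mul_mem _ hfmem hAmem
  -- step 1: bring `ρ` next to `j`
  have hc1 : ρ * (f * A) = f * A * ρ :=
    (commute_of_mem_carEvenSubalgebra hρmem (carEvenSubalgebra_le_carSubalgebra _ hfA) hdisj).eq
  have step1 : P * (ρ * f) * (A * j) = P * (f * A) * (ρ * j) := by
    calc P * (ρ * f) * (A * j) = P * ((ρ * (f * A)) * j) := by simp only [Matrix.mul_assoc]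
      _ = P * ((f * A * ρ) * j) := by rw [hc1]
      _ = P * (f * A) * (ρ * j) := by simp only [Matrix.mul_assoc]
  rw [step1]
  -- step 2: the regional resolution of the identity
  rw [show P * (f * A) = P * 1 * (f * A) by rw [Matrix.mul_one], ← sum_sum_diagonal_regional_eq_one S,
    Finset.mul_sum, Finset.sum_mul, Finset.sum_mul, Matrix.trace_sum]
  refine Finset.sum_eq_zero fun u _ => ?_
  rw [Finset.mul_sum, Finset.sum_mul, Finset.sum_mul, Matrix.trace_sum]
  refine Finset.sum_eq_zero fun v _ => ?_
  -- step 3: one regional sector `(u, v)`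
  have hPr_mem : diagonal (fun s : Finset (Orb Λ) =>
      if (upPart s ∩ S).card = u ∧ (downPart s ∩ S).card = v then (1 : ℂ) else 0) ∈ carEvenSubalgebra (orbSet S) :=
    diagonal_regional_card_mem S (fun u' v' => if u' = u ∧ v' = v then (1 : ℂ) else 0)
  have hD_mem : diagonal (fun s : Finset (Orb Λ) =>
      if u + (upPart s \ S).card = M ∧ v + (downPart s \ S).card = N then (1 : ℂ) else 0) ∈ carEvenSubalgebra (orbSet Sᶜ) :=
    diagonal_coregional_card_mem S (fun u' v' => if u + u' = M ∧ v + v' = N then (1 : ℂ) else 0)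
  rw [hP, spinSectorProj_mul_diagonal_regional S M N u v]
  have hPrC : diagonal (fun s : Finset (Orb Λ) =>
      if (upPart s ∩ S).card = u ∧ (downPart s ∩ S).card = v then (1 : ℂ) else 0) * (f * A) =
      f * A * diagonal (fun s : Finset (Orb Λ) => if (upPart s ∩ S).card = u ∧ (downPart s ∩ S).card = v then (1 : ℂ) else 0) :=
    (commute_of_mem_carEvenSubalgebra hPr_mem (carEvenSubalgebra_le_carSubalgebra _ hfA) hdisj).eq
  rw [Matrix.mul_assoc (diagonal _) (diagonal _) (f * A), hPrC, ← Matrix.mul_assoc (diagonal _) (f * A),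
    Matrix.mul_assoc _ (diagonal _) (ρ * j)]
  -- step 4: the trace over the region `S` vanishes by time reversal
  have hzero : (diagonal (fun s : Finset (Orb Λ) =>
      if (upPart s ∩ S).card = u ∧ (downPart s ∩ S).card = v then (1 : ℂ) else 0) * (ρ * j)).trace = 0 := by
    rw [← Matrix.mul_assoc, Matrix.trace_mul_comm]
    refine trace_mul_eq_zero_of_transpose (transpose_current a b) (transpose_mul_of_commute (diagonal_transpose _) ?_ ?_)
    · rw [hρ, transpose_sum]
      refine Finset.sum_congr rfl fun T _ => ?_
      rw [transpose_smul, gibbsWeight, transpose_exp_smul_sum_hubbardTermOp]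
    · rw [hρ]
      refine Commute.sum_right _ _ _ fun T hT => Commute.smul_right ?_ _
      rw [gibbsWeight]
      refine (Commute.smul_right (Commute.sum_right _ _ _ fun Z hZ => ?_) _).exp_right
      exact (commute_diagonal_regional (carEvenSubalgebra_mono (orbSet_mono (hKS Z (Finset.mem_powerset.1 hT hZ)))
        (hubbardTermOp_mem_carEvenSubalgebra G t U μ Z)) (preservesSectors_hubbardTermOp G t U μ Z)
        (fun u' v' => if u' = u ∧ v' = v then (1 : ℂ) else 0)).symm
  have hfac := trace_mul_of_mem_carSubalgebra (carEvenSubalgebra_le_carSubalgebra _ (Subalgebra.mul_mem _ hD_mem hfA))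
    (carEvenSubalgebra_le_carSubalgebra _ (Subalgebra.mul_mem _ hPr_mem (Subalgebra.mul_mem _ hρmem hjmem))) hdisj.symm
  rw [hzero, mul_zero] at hfac
  exact (mul_eq_zero.1 hfac).resolve_right (pow_ne_zero _ two_ne_zero)

/-! ## §4 Only the polymers reaching the test observable contribute -/

/-- **The canonical current correlation as a sum over polymers reaching `X`.** For every even observable `A` of `X` and every spin
sector `(M,N)`: `tr(P_{M,N} e^{−βH} A j_{ab}) = Σ_{K admissible, reaching X} tr(P_{M,N} ρ_K e^{−βH_{far(K)}} A j_{ab})`. [folklore] -/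
theorem trace_proj_gibbsWeight_mul_current_eq_sum (β : ℝ) (a b : Λ) (M N : ℕ)
    {X : Finset Λ} {A : Matrix (Finset (Orb Λ)) (Finset (Orb Λ)) ℂ} (hA : A ∈ carEvenSubalgebra (orbSet X)) :
    (spinSectorProj M N * gibbsWeight β (∑ Z, hubbardTermOp G t U μ Z) *
        (A * ∑ σ : Fin 2, ((-Complex.I) • (creation (orb a σ) * annihilation (orb b σ)) +
          Complex.I • (creation (orb b σ) * annihilation (orb a σ))))).trace =
      ∑ K ∈ (Finset.univ : Finset (HubbardIdx G)).powerset.filter (fun K => (∀ Z ∈ K, ∃ w ∈ hubbardTermSupp G Z,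
          ∃ r ∈ ({a, b} : Finset Λ), Relation.ReflTransGen
            (fun x y : Λ => ∃ Z ∈ K, x ∈ hubbardTermSupp G Z ∧ y ∈ hubbardTermSupp G Z) r w) ∧
          ∃ x ∈ X, ∃ r ∈ ({a, b} : Finset Λ), Relation.ReflTransGen
            (fun x y : Λ => ∃ Z ∈ K, x ∈ hubbardTermSupp G Z ∧ y ∈ hubbardTermSupp G Z) r x),
        (spinSectorProj M N *
          ((∑ T ∈ K.powerset, ((-1 : ℂ) ^ (K \ T).card) • gibbsWeight β (∑ Z ∈ T, hubbardTermOp G t U μ Z)) *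
            gibbsWeight β (∑ Z ∈ Finset.univ.filter (fun Z => ∀ w ∈ hubbardTermSupp G Z, ¬ ∃ r ∈ ({a, b} : Finset Λ),
              Relation.ReflTransGen (fun x y : Λ => ∃ Z ∈ K, x ∈ hubbardTermSupp G Z ∧ y ∈ hubbardTermSupp G Z) r w),
              hubbardTermOp G t U μ Z)) *
          (A * ∑ σ : Fin 2, ((-Complex.I) • (creation (orb a σ) * annihilation (orb b σ)) +
            Complex.I • (creation (orb b σ) * annihilation (orb a σ))))).trace := by
  rw [gibbsWeight_eq_sum_admissible G t U μ β a b, Finset.mul_sum, Finset.sum_mul, Matrix.trace_sum,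
    ← Finset.sum_filter_add_sum_filter_not _ (fun K : Finset (HubbardIdx G) => ∃ x ∈ X, ∃ r ∈ ({a, b} : Finset Λ),
      Relation.ReflTransGen (fun x y : Λ => ∃ Z ∈ K, x ∈ hubbardTermSupp G Z ∧ y ∈ hubbardTermSupp G Z) r x),
    Finset.filter_filter, Finset.filter_filter]
  have hvan : ∑ K ∈ (Finset.univ : Finset (HubbardIdx G)).powerset.filter (fun K => (∀ Z ∈ K, ∃ w ∈ hubbardTermSupp G Z,
      ∃ r ∈ ({a, b} : Finset Λ), Relation.ReflTransGen
        (fun x y : Λ => ∃ Z ∈ K, x ∈ hubbardTermSupp G Z ∧ y ∈ hubbardTermSupp G Z) r w) ∧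
      ¬ ∃ x ∈ X, ∃ r ∈ ({a, b} : Finset Λ), Relation.ReflTransGen
        (fun x y : Λ => ∃ Z ∈ K, x ∈ hubbardTermSupp G Z ∧ y ∈ hubbardTermSupp G Z) r x),
      (spinSectorProj M N *
        ((∑ T ∈ K.powerset, ((-1 : ℂ) ^ (K \ T).card) • gibbsWeight β (∑ Z ∈ T, hubbardTermOp G t U μ Z)) *
          gibbsWeight β (∑ Z ∈ Finset.univ.filter (fun Z => ∀ w ∈ hubbardTermSupp G Z, ¬ ∃ r ∈ ({a, b} : Finset Λ),
            Relation.ReflTransGen (fun x y : Λ => ∃ Z ∈ K, x ∈ hubbardTermSupp G Z ∧ y ∈ hubbardTermSupp G Z) r w),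
            hubbardTermOp G t U μ Z)) *
        (A * ∑ σ : Fin 2, ((-Complex.I) • (creation (orb a σ) * annihilation (orb b σ)) +
          Complex.I • (creation (orb b σ) * annihilation (orb a σ))))).trace = 0 := by
    refine Finset.sum_eq_zero fun K hK => ?_
    obtain ⟨-, hKadm, hKX⟩ := Finset.mem_filter.1 hK
    exact trace_term_eq_zero_of_not_reach G t U μ β a b M N hKadm hA fun x hx h => hKX ⟨x, hx, h⟩
  rw [hvan, add_zero]

end Summit.Ventures.CertifiedManyBodySolver.Theorems.TcThermcert1.HighTempCurrentClustering

end
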